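import Summits.QuantumFields.YangMills.Theorems.SwapVirialDeficitBlowUpPeriodicTwoScaleJoint
import Summits.QuantumFields.YangMills.Theorems.SwapVirialDeficitBlowUpPeriodicTwoScaleChartLevel
import HarnessLib

/-!
# The PERIODIC massive-mode rung, PM-IIb at a GENERAL LEVEL `r`: the fibre `twoScaleFibreR` in terms of `Φ`, the pointwise two-scale limit at level `r`,
# and «good thresholds» (the null level fails for at most countably many `r`)
# (free-hands support of ⟨stmt-QuantumFields-24196⟩ `SwapVirialDeficit.ToronSoftnessSharp`; LEAD memo `sfw-p2-g96-memo-24196-PM-design.md` §2 «good-threshold route»;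
# consumes ✓PM-IIb/IIb″ `twoScaleDeficit_eq_pow_four_mul_sq_phi`, `continuousOn_twoScalePhi`, ✓`periodicBlowUpPoint_twoScale`, ✓`twoScaleFibreR`)

* ★★ `mem_twoScaleFibreR_iff` — for `u > 0`: `(w', y) ∈ twoScaleFibreR L r u s a₀ ⟺ side conditions ∧ G(u, s; a₀, w', y) ≤ r·(u²s)²`
  (✓`periodicBlowUpPoint_twoScale`, ✓`dilate_scaleQ_eq_twoScaleRaw`);
* ★ `twoScaleDeficit_le_iff_level` — off the axes `G ≤ r(u²s)² ⟺ Φ ≤ r`; ★★ `eventually_twoScaleDeficit_le_iff_level` — as `(u, s, a') → (0, 0, a₀)`,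
  `G(u,s;a',w',y) ≤ r(u²s)² ⟺ Φ(0,0;a₀,w',y) < r` eventually, whenever `Φ(0,0;a₀,w',y) ≠ r`;
* ★★ `countable_bad_levels` — for any σ-finite measure `μ` on the slice parameters, `{r | 0 < μ {z | Φ(0,0;z) = r}}` is countable
  (✓`Measure.countable_meas_level_set_pos`): PM may choose its level with a null limit level set.
HONEST LABEL: plan-level fixed-`L` rung of a DRAFT line; PM NOT proved; ⟨24196⟩/⟨24194⟩/⟨24197⟩/⟨24497⟩ OPEN; own crux ⟨22884⟩ OPEN (blocked-on ⟨19935⟩);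
the Yang–Mills mass gap is NOT proved; no summit is proved by a line.
LEAD seat ym-line-sfw-p2 g96 (cell ym-idea-1, free hands), `--supports stmt-QuantumFields-24196`.  THEOREMS ONLY, standard axioms, 0 `sorry`.
References: [cite: Luscher1983, §2]; [cite: GonzalezarroyoAltes1988]; [folklore].
-/

set_option autoImplicit false

noncomputable section

open MeasureTheory Quaternion Set Filter Topology
open scoped Quaternion BigOperators ENNReal
open Literature.MathematicalPhysics.QuantumLattice
open Literature.MathematicalPhysics.QuantumFieldTheory hiding SU2
open Summit.QuantumFields.YangMills.Theorems.SwapTwistDeficit.ToronLog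

namespace Summit.QuantumFields.YangMills.Theorems.SwapVirialDeficit.BlowUpRing

open Summit.QuantumFields.YangMills.Theorems.FemtoTransferGap
open Summit.QuantumFields.YangMills.Theorems.FemtoTransferGap.TT
open Summit.QuantumFields.YangMills.Theorems.SwapVirialDeficit.ZeroModeSigma (ball3 mem_ball3_iff dilateIm)
open Summit.QuantumFields.YangMills.Theorems.SwapVirialDeficit.ZeroModeGroup (scaleQ3 scaleQ3_apply)
open Summit.QuantumFields.YangMills.Theorems.SwapVirialDeficit.BlowUp (dil3P dil3P_apply)
open Summit.QuantumFields.YangMills.Theorems.SwapVirialDeficit.TwoScaleCalculus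

variable {L : ℕ} [NeZero L]

/-! ## §1 The level-`r` fibre in terms of the two-scale deficit -/

/-- ★★ **THE LEVEL-`r` FIBRE IS `{side conditions ∧ G ≤ r·(u²s)²}`** (`u > 0`): the three leader balls `‖twoScaleRaw u s ·‖ < 1`, the follower balls
`‖dilateIm (u²s) y_i‖ < 1`, and the deficit condition. [folklore] -/
theorem mem_twoScaleFibreR_iff {u : ℝ} (hu : 0 < u) (r s a₀ : ℝ) (q : ((ℍ × ℍ) × ℍ) × (Fol L → ℍ)) :
    q ∈ twoScaleFibreR L r u s a₀ ↔
      ((‖twoScaleRaw u s q.1.1.1‖ < 1 ∧ ‖twoScaleRaw u s q.1.1.2‖ < 1) ∧ ‖twoScaleRaw u s q.1.2‖ < 1) ∧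
        (∀ i, ‖dilateIm (u ^ 2 * s) (q.2 i)‖ < 1) ∧ twoScaleDeficit L u s a₀ q.1 q.2 ≤ r * (u ^ 2 * s) ^ 2 := by
  unfold twoScaleFibreR periodicBlowUpSet
  simp only [Set.mem_setOf_eq]
  rw [periodicBlowUpPoint_twoScale hu, dil3P_apply, scaleQ3_apply, mem_ball3_iff]
  simp only [dilate_scaleQ_eq_twoScaleRaw hu.ne']
  rfl

/-! ## §2 The deficit condition at level `r` and its pointwise limit -/

/-- ★ Off the axes: `G ≤ r(u²s)² ⟺ Φ ≤ r`. [folklore] -/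
theorem twoScaleDeficit_le_iff_level {a₀ : ℝ} {w' : (ℍ × ℍ) × ℍ} {y : Fol L → ℍ} (hx : w'.1.1.re ≠ 0) (hy' : w'.1.2.re ≠ 0) (hz : w'.2.re ≠ 0)
    (ha : a₀ ≠ 0) (hf : ∀ i, 0 < (y i).re) (r : ℝ) {u s : ℝ} (hu : u ≠ 0) (hs : s ≠ 0) :
    twoScaleDeficit L u s a₀ w' y ≤ r * (u ^ 2 * s) ^ 2 ↔ twoScalePhi L u s a₀ w' y ≤ r := by
  rw [twoScaleDeficit_eq_pow_four_mul_sq_phi hx hy' hz ha hf u s]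
  have hpos : 0 < u ^ 4 * s ^ 2 := by positivity
  rw [show r * (u ^ 2 * s) ^ 2 = u ^ 4 * s ^ 2 * r by ring]
  exact ⟨fun h => le_of_mul_le_mul_left h hpos, fun h => mul_le_mul_of_nonneg_left h hpos.le⟩

/-- ★★ **THE POINTWISE TWO-SCALE LIMIT AT LEVEL `r`, hub moving**: if `Φ(0,0;a₀,w',y) ≠ r`, then as `(u, s, a') → (0, 0, a₀)` through `u, s ≠ 0`,
`G(u, s; a', w', y) ≤ r(u²s)²  ⟺  Φ(0, 0; a₀, w', y) < r` eventually. [folklore] -/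
theorem eventually_twoScaleDeficit_le_iff_level {a₀ : ℝ} {w' : (ℍ × ℍ) × ℍ} {y : Fol L → ℍ} (hx : w'.1.1.re ≠ 0) (hy' : w'.1.2.re ≠ 0)
    (hz : w'.2.re ≠ 0) (ha : a₀ ≠ 0) (hf : ∀ i, 0 < (y i).re) (r : ℝ) (hne : twoScalePhi L 0 0 a₀ w' y ≠ r) :
    ∀ᶠ q : (ℝ × ℝ) × ℝ in 𝓝[{q | q.1.1 ≠ 0 ∧ q.1.2 ≠ 0}] (((0 : ℝ), (0 : ℝ)), a₀),
      (twoScaleDeficit L q.1.1 q.1.2 q.2 w' y ≤ r * (q.1.1 ^ 2 * q.1.2) ^ 2 ↔ twoScalePhi L 0 0 a₀ w' y < r) := by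
  have hmem : (((0 : ℝ), (0 : ℝ), a₀, w', y) : TwoScaleParam L) ∈ {p : TwoScaleParam L | p.2.2 ∈ sliceGood L} :=
    mem_sliceGood ha hx hy' hz fun i => (hf i).ne'
  have hopen : IsOpen {p : TwoScaleParam L | p.2.2 ∈ sliceGood L} := isOpen_planeProd isOpen_sliceGood
  have hcont : ContinuousAt (fun p : TwoScaleParam L => twoScalePhi L p.1 p.2.1 p.2.2.1 p.2.2.2.1 p.2.2.2.2) ((0 : ℝ), (0 : ℝ), a₀, w', y) :=
    continuousOn_twoScalePhi.continuousAt (hopen.mem_nhds hmem)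
  have hι : Continuous fun q : (ℝ × ℝ) × ℝ => ((q.1.1, q.1.2, q.2, w', y) : TwoScaleParam L) :=
    (continuous_fst.comp continuous_fst).prodMk ((continuous_snd.comp continuous_fst).prodMk (continuous_snd.prodMk continuous_const))
  have key : ContinuousAt (fun q : (ℝ × ℝ) × ℝ => twoScalePhi L q.1.1 q.1.2 q.2 w' y) (((0 : ℝ), (0 : ℝ)), a₀) := by
    have e : (fun q : (ℝ × ℝ) × ℝ => twoScalePhi L q.1.1 q.1.2 q.2 w' y) =
        (fun p : TwoScaleParam L => twoScalePhi L p.1 p.2.1 p.2.2.1 p.2.2.2.1 p.2.2.2.2) ∘ (fun q : (ℝ × ℝ) × ℝ => ((q.1.1, q.1.2, q.2, w', y) : TwoScaleParam L)) := rfl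
    rw [e]
    exact ContinuousAt.comp hcont hι.continuousAt
  have hΦ : Tendsto (fun q : (ℝ × ℝ) × ℝ => twoScalePhi L q.1.1 q.1.2 q.2 w' y) (𝓝 (((0 : ℝ), (0 : ℝ)), a₀)) (𝓝 (twoScalePhi L 0 0 a₀ w' y)) :=
    key.tendsto
  have ha' : ∀ᶠ q : (ℝ × ℝ) × ℝ in 𝓝 (((0 : ℝ), (0 : ℝ)), a₀), q.2 ≠ 0 :=
    (continuous_snd.continuousAt (x := (((0 : ℝ), (0 : ℝ)), a₀))).eventually_ne ha
  rcases lt_or_gt_of_ne hne with hlt | hgt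
  · have hev : ∀ᶠ q : (ℝ × ℝ) × ℝ in 𝓝 (((0 : ℝ), (0 : ℝ)), a₀), twoScalePhi L q.1.1 q.1.2 q.2 w' y < r := hΦ (Iio_mem_nhds hlt)
    filter_upwards [mem_nhdsWithin_of_mem_nhds hev, mem_nhdsWithin_of_mem_nhds ha', self_mem_nhdsWithin] with q hq hqa hq0
    rw [twoScaleDeficit_le_iff_level hx hy' hz hqa hf r hq0.1 hq0.2]
    exact ⟨fun _ => hlt, fun _ => hq.le⟩
  · have hev : ∀ᶠ q : (ℝ × ℝ) × ℝ in 𝓝 (((0 : ℝ), (0 : ℝ)), a₀), r < twoScalePhi L q.1.1 q.1.2 q.2 w' y := hΦ (Ioi_mem_nhds hgt)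
    filter_upwards [mem_nhdsWithin_of_mem_nhds hev, mem_nhdsWithin_of_mem_nhds ha', self_mem_nhdsWithin] with q hq hqa hq0
    rw [twoScaleDeficit_le_iff_level hx hy' hz hqa hf r hq0.1 hq0.2]
    exact ⟨fun h => absurd (lt_of_lt_of_le hq h) (lt_irrefl _), fun h => absurd (h.trans hgt) (lt_irrefl _)⟩

/-! ## §3 Good thresholds: the null limit level fails for at most countably many `r` -/

/-- ★★ **COUNTABLY MANY BAD LEVELS**: for any σ-finite measure `μ` on a measurable space and any function `Φ₀`, the set of levels `r` whose level set
`{z | Φ₀ z = r}` has positive `μ`-measure is countable (✓`Measure.countable_meas_level_set_pos`); so PM may choose `r > 0` with a `μ`-null limit level set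
(and then, by Fubini, null sections for a.e. hub coordinate). [folklore] -/
theorem countable_bad_levels {Z : Type*} [MeasurableSpace Z] (μ : Measure Z) [SigmaFinite μ] {Φ₀ : Z → ℝ} (hΦ : Measurable Φ₀) :
    Set.Countable {r : ℝ | 0 < μ {z | Φ₀ z = r}} :=
  Measure.countable_meas_level_set_pos hΦ

/-- ★ Hence there are GOOD levels in every interval: some `r ∈ (a, b)` (`a < b`) has a `μ`-null limit level set. [folklore] -/
theorem exists_good_level_Ioo {Z : Type*} [MeasurableSpace Z] (μ : Measure Z) [SigmaFinite μ] {Φ₀ : Z → ℝ} (hΦ : Measurable Φ₀) {a b : ℝ}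
    (hab : a < b) : ∃ r ∈ Set.Ioo a b, μ {z | Φ₀ z = r} = 0 := by
  have hc := countable_bad_levels μ hΦ
  have hunc : ¬ (Set.Ioo a b).Countable := by
    intro hcount
    have h1 := hcount.le_aleph0
    rw [Cardinal.mk_Ioo_real hab] at h1
    exact (not_le_of_gt Cardinal.aleph0_lt_continuum) h1
  obtain ⟨r, hr, hnot⟩ : ∃ r ∈ Set.Ioo a b, r ∉ {r : ℝ | 0 < μ {z | Φ₀ z = r}} := by
    by_contra h
    apply hunc
    refine hc.mono fun r hr => ?_
    by_contra h'
    exact h ⟨r, hr, h'⟩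
  refine ⟨r, hr, ?_⟩
  simp only [Set.mem_setOf_eq, not_lt, nonpos_iff_eq_zero] at hnot
  exact hnot

end Summit.QuantumFields.YangMills.Theorems.SwapVirialDeficit.BlowUpRing

end
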